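import Summits.AtomisticToContinuum.FouriersLaw.Theorems.HonestZwanzigRobinCoercivityResidues
import Summits.AtomisticToContinuum.FouriersLaw.Theorems.HonestZwanzigRobinCoercivityOhmBulk
import Summits.AtomisticToContinuum.FouriersLaw.Theorems.HonestZwanzigRobinCoercivityOhmOfBlockInputsAux

/-!
# `HonestZwanzig.RobinCoercivity`, line `limit-operator-memory-form`: the rank-2 inputs imply `OrthogonalOhm`

Support file for the crux `stmt-AtomisticToContinuum-12695` (`RobinCoercivity` of route `HonestZwanzig`, sub-problem
`FouriersLaw`), line `limit-operator-memory-form`, registered LINK theorem `orthogonalOhm_of_blockInputs`: the line's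
rank-2 inputs — (U′) `BlockBandDomination` (uniform off-band `ℓ¹` row tails `τ(d)` of the block memory matrix
`W_N(s)`), (L) `BlockBulkLimit` (summable bulk Toeplitz limit of `W_N(s)` at every fixed distance) and `FluxRowBound`
(uniform bound `C_F` of the rows of `W_N(s)` against the flux direction `u = (1,…,1,−1)`) — IMPLY the route's rank-2
crux `OrthogonalOhm` (stmt-AtomisticToContinuum-12693) AS TYPED, so that `OrthogonalOhm` becomes a corollary of the
shared items.

Proof. Positions `i : Fin (N+1)` (`0`, `N` = contacts, `1 … N−1` = bonds `b = i − 1`), `J = Σ_c j_c`.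
(i) EXISTENCE of the limits at fixed `N`: `schur_s(f, h) → schur_0(f, h)` as `s ↓ 0` for admissible `f, h`
(`tendsto_schur_of_isUnit_det`, the engine of `stub_fixedNLimits`, with `det G(0) ≠ 0` from `stub_G0PosDef`); bond
currents, `J` and `p_c²` are admissible. (ii) BOND ROWS `i = b + 1 ≤ N − 1`: `Σ_{bond j} W_N(s)_{ij} = schur_s(j_b, J)`
(`bulk_row_sum_pkg`), and `Σ_{bond j} W_{ij} = Σ_j W_{ij}u_j − W_{i0} + W_{iN}` with `W_{i0}, W_{iN}` off-diagonal, so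
`|schur_s(j_b, J)| ≤ C_F + τ(0)` for small `s` (`ohm2_bond_row_abs_le`), and `|schur_s(j_b, J) − k| ≤ ε` for `b` at
distance `≥ R` from both ends by the landed link `bulkRowSum_of_blockInputs` ((U′) ∧ (L) ⇒ bulk bond-row sums
`ε`-close to `k = Σ' K_∞`); both bounds pass to the limit `ρ_b` (`le_of_tendsto`). (iii) CONTACT ROWS `i = 0, N`
(sites `c = 0, N − 1`): `Σ_{bond j} W_N(s)_{ij} = γ·schur_s(p_c², J)` (`ohm2_contact_row_sum_pkg`: `g_i∘Θ = γ(T − p_c²)`,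
first-slot affinity, second-slot linearity), and the bond columns are off-diagonal for a contact row, so
`|schur_s(p_c², J)| ≤ τ(0)/γ`, which passes to the limit `w_c`. Constants: `k` from `bulkRowSum_of_blockInputs`,
`C = max (C_F + τ(0)) (τ(0)/γ)`.
-/

noncomputable section

open MeasureTheory Finset Matrix Filter Topology
open Literature.MathematicalPhysics.KineticTheory.HeatConduction
open Summit.AtomisticToContinuum.FouriersLaw.Theses.HonestZwanzig
open Summit.AtomisticToContinuum.FouriersLaw.Theorems.HonestZwanzig.NetworkReduction

namespace Summit.AtomisticToContinuum.FouriersLaw.Theorems.HonestZwanzig.Robin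

/-! ### Both clauses of `OrthogonalOhm` at one fixed `N`, canonical objects -/

/-- **`OrthogonalOhm` at fixed `N` from the per-`N` clauses.** For `pinnedChain ω₂ lam β γ` (all `> 0`), `T > 0`,
`N ≥ 2` and the line's gadgets `lap, e, G, schur, g, W` with their defining equations: if for small `s > 0` the rows of
`W_N(s)` have off-band tails `≤ τ(d)` (band clause, `s < s₁`), satisfy the flux-row bound `|Σ_j W_{ij}u_j| ≤ C_F`
(`s < s₂`) and have bulk bond-row sums `ε`-close to `k` at distance `> R` from the contacts (`s < s₃`), then every
orthogonal DC response `ρ_b = lim_{s↓0} schur_s(j_b, J)` (`b + 1 < N`) exists with `|ρ_b| ≤ max (C_F + τ 0) (τ 0/γ)`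
and `|ρ_b − k| ≤ ε` for `R ≤ b`, `b + 2 + R ≤ N`, and both contact responses `w_c = lim_{s↓0} schur_s(p_c², J)`,
`c ∈ {0, N−1}`, exist with `|w_c| ≤ max (C_F + τ 0) (τ 0/γ)`. -/
theorem ohm2_fixedN {ω₂ lam β γ T : ℝ} (hω : 0 < ω₂) (hl : 0 < lam) (hβ : 0 < β) (hγ : 0 < γ) (hT : 0 < T)
    {N : ℕ} (hN : 2 ≤ N)
    (lap : ℝ → (PhaseSpace N → ℝ) → (PhaseSpace N → ℝ) → ℝ) (e : Fin N → PhaseSpace N → ℝ)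
    (G : ℝ → Matrix (Fin N) (Fin N) ℝ) (schur : ℝ → (PhaseSpace N → ℝ) → (PhaseSpace N → ℝ) → ℝ)
    (g : Fin (N + 1) → PhaseSpace N → ℝ) (W : ℝ → Fin (N + 1) → Fin (N + 1) → ℝ)
    (hlap : ∀ s f₁ f₂, lap s f₁ f₂ = ∫ t in Set.Ioi (0 : ℝ), Real.exp (-(s * t)) *
      ((∫ z, f₁ z * (∫ y, f₂ y ∂((pinnedChain ω₂ lam β γ).transitionKernel N T T t.toNNReal z))
          ∂(pinnedChain ω₂ lam β γ).gibbsMeasure N T) -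
        (∫ z, f₁ z ∂(pinnedChain ω₂ lam β γ).gibbsMeasure N T) *
          (∫ z, f₂ z ∂(pinnedChain ω₂ lam β γ).gibbsMeasure N T)))
    (he : ∀ x z, e x z = z.2 x ^ 2 / 2 + (pinnedChain ω₂ lam β γ).U (z.1 x) +
      ∑ j : Fin N, ((if j.val = x.val + 1 then (pinnedChain ω₂ lam β γ).V (z.1 j - z.1 x) / 2 else 0) +
        (if x.val = j.val + 1 then (pinnedChain ω₂ lam β γ).V (z.1 x - z.1 j) / 2 else 0)))
    (hG : ∀ s, G s = Matrix.of fun x y => lap s (e x) (e y))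
    (hschur : ∀ s f₁ f₂, schur s f₁ f₂ = lap s f₁ f₂ - ∑ x, ∑ y, lap s f₁ (e x) * (G s)⁻¹ x y * lap s (e y) f₂)
    (hg : ∀ i z, g i z = (∑ b : Fin N, if b.val + 1 = i.val then (pinnedChain ω₂ lam β γ).bondCurrent N b z else 0) +
      (∑ x : Fin N, if (i.val = 0 ∧ x.val = 0) ∨ (i.val = N ∧ x.val + 1 = N) then
        (pinnedChain ω₂ lam β γ).γ * (T - z.2 x ^ 2) else 0))
    (hW : ∀ s i j, W s i j = (if i = j ∧ (i.val = 0 ∨ i.val = N) then (pinnedChain ω₂ lam β γ).γ * T ^ 2 else 0) -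
      schur s (fun z => g i (z.1, -z.2)) (g j))
    (k CF ε s₁ s₂ s₃ : ℝ) (hs₁ : 0 < s₁) (hs₂ : 0 < s₂) (hs₃ : 0 < s₃) (τ : ℕ → ℝ) (R : ℕ)
    (hBi : ∀ s : ℝ, 0 < s → s < s₁ → ∀ (i : Fin (N + 1)) (d : ℕ),
      ∑ j : Fin (N + 1), (if (d : ℝ) < |(i.val : ℝ) - j.val| then |W s i j| else 0) ≤ τ d)
    (hFi : ∀ s : ℝ, 0 < s → s < s₂ → ∀ i : Fin (N + 1),
      |∑ j : Fin (N + 1), W s i j * (if j.val = N then -1 else 1)| ≤ CF)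
    (hRi : ∀ s : ℝ, 0 < s → s < s₃ → ∀ i : Fin (N + 1), R + 1 ≤ i.val → i.val + 1 + R ≤ N →
      |(∑ j : Fin (N + 1), if 1 ≤ j.val ∧ j.val + 1 ≤ N then W s i j else 0) - k| ≤ ε) :
    (∀ b : Fin N, b.val + 1 < N → ∃ ρ : ℝ,
      Tendsto (fun s => schur s ((pinnedChain ω₂ lam β γ).bondCurrent N b)
        (fun z => ∑ i : Fin N, (pinnedChain ω₂ lam β γ).bondCurrent N i z))
        (nhdsWithin (0 : ℝ) (Set.Ioi 0)) (nhds ρ) ∧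
      |ρ| ≤ max (CF + τ 0) (τ 0 / γ) ∧ (R ≤ b.val → b.val + 2 + R ≤ N → |ρ - k| ≤ ε)) ∧
    (∀ b : Fin N, (b.val = 0 ∨ b.val = N - 1) → ∃ w : ℝ,
      Tendsto (fun s => schur s (fun z => z.2 b ^ 2)
        (fun z => ∑ i : Fin N, (pinnedChain ω₂ lam β γ).bondCurrent N i z))
        (nhdsWithin (0 : ℝ) (Set.Ioi 0)) (nhds w) ∧
      |w| ≤ max (CF + τ 0) (τ 0 / γ)) := by
  classical
  obtain rfl : lap = fun s f g => ∫ t in Set.Ioi (0 : ℝ), Real.exp (-(s * t)) *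
      ((∫ z, f z * (∫ y, g y ∂((pinnedChain ω₂ lam β γ).transitionKernel N T T t.toNNReal z))
          ∂(pinnedChain ω₂ lam β γ).gibbsMeasure N T) -
        (∫ z, f z ∂(pinnedChain ω₂ lam β γ).gibbsMeasure N T) *
          (∫ z, g z ∂(pinnedChain ω₂ lam β γ).gibbsMeasure N T)) :=
    funext fun s => funext fun f => funext fun g => hlap s f g
  obtain rfl : e = fun x z => z.2 x ^ 2 / 2 + (pinnedChain ω₂ lam β γ).U (z.1 x) +
      ∑ j : Fin N, ((if j.val = x.val + 1 then (pinnedChain ω₂ lam β γ).V (z.1 j - z.1 x) / 2 else 0) +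
        (if x.val = j.val + 1 then (pinnedChain ω₂ lam β γ).V (z.1 x - z.1 j) / 2 else 0)) :=
    funext fun x => funext fun z => he x z
  obtain ⟨-, hFI2, -, -⟩ := stub_feshbachIdentities ω₂ lam β γ hω hl hβ hγ T hT N hN
  have hG0 := stub_G0PosDef ω₂ lam β γ hω hl hβ hγ T hT N hN
  dsimp only at hG0
  -- `det G(0) ≠ 0` from `G(0) ≻ 0`
  have hdet : IsUnit (G 0).det := by
    rw [isUnit_iff_ne_zero]
    intro hdet0
    obtain ⟨v, hv, hGv⟩ := Matrix.exists_mulVec_eq_zero_iff.2 hdet0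
    have hq : ∑ x, ∑ y, v x * G 0 x y * v y = 0 := by
      have hx : ∀ x, ∑ y, v x * G 0 x y * v y = v x * (G 0 *ᵥ v) x := fun x => by
        rw [Matrix.mulVec_apply_eq_sum, Finset.mul_sum]
        exact Finset.sum_congr rfl fun y _ => by ring
      simp only [hx, hGv, Pi.zero_apply, mul_zero, Finset.sum_const_zero]
    have hpos := hG0 v hv
    simp only [hG, Matrix.of_apply] at hq hpos
    exact hpos.ne' hq
  -- admissibility of `J`, and the limit engine of `stub_fixedNLimits`
  have hadm_J := adm_totalCurrent (fun f : PhaseSpace N → ℝ => Continuous f ∧ ∃ A : ℝ, ∀ z,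
      |f z| ≤ A * Real.exp ((pinnedChain ω₂ lam β γ).hamiltonian N z / (8 * T))) (fun f => Iff.rfl) hω hl.le hβ.le hT
  have hlim : ∀ f₁ f₂ : PhaseSpace N → ℝ,
      (Continuous f₁ ∧ ∃ A : ℝ, ∀ z, |f₁ z| ≤ A * Real.exp ((pinnedChain ω₂ lam β γ).hamiltonian N z / (8 * T))) →
      (Continuous f₂ ∧ ∃ A : ℝ, ∀ z, |f₂ z| ≤ A * Real.exp ((pinnedChain ω₂ lam β γ).hamiltonian N z / (8 * T))) →
      Tendsto (fun s => schur s f₁ f₂) (nhdsWithin (0 : ℝ) (Set.Ioi 0)) (nhds (schur 0 f₁ f₂)) :=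
    fun f₁ f₂ hf₁ hf₂ => OrthogonalOhmLine.FixedNLimits.tendsto_schur_of_isUnit_det
      (Adm := fun f : PhaseSpace N → ℝ => Continuous f ∧ ∃ A : ℝ, ∀ z,
        |f z| ≤ A * Real.exp ((pinnedChain ω₂ lam β γ).hamiltonian N z / (8 * T)))
      (corr := fun f₁ f₂ t => (∫ z, f₁ z * (∫ y, f₂ y ∂((pinnedChain ω₂ lam β γ).transitionKernel N T T
        t.toNNReal z)) ∂(pinnedChain ω₂ lam β γ).gibbsMeasure N T) -
        (∫ z, f₁ z ∂(pinnedChain ω₂ lam β γ).gibbsMeasure N T) * (∫ z, f₂ z ∂(pinnedChain ω₂ lam β γ).gibbsMeasure N T))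
      (cov := fun f₁ f₂ => (∫ z, f₁ z * f₂ z ∂(pinnedChain ω₂ lam β γ).gibbsMeasure N T) -
        (∫ z, f₁ z ∂(pinnedChain ω₂ lam β γ).gibbsMeasure N T) * (∫ z, f₂ z ∂(pinnedChain ω₂ lam β γ).gibbsMeasure N T))
      (G := G) (fun f => Iff.rfl) (fun s f g => rfl) (fun x z => rfl) (fun s x y => by rw [hG]; rfl) hschur hFI2 hω
      hl.le hβ.le hT hdet hf₁ hf₂
  -- the bond-row identity `Σ_{bond j} W_{ij} = schur_s(j_b, J)` at a fixed `s ≥ 0`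
  have hbond : ∀ {s : ℝ}, 0 ≤ s → ∀ (i : Fin (N + 1)) (b : Fin N), b.val + 1 = i.val → i.val ≠ N →
      ∑ j : Fin (N + 1), (if j.val ≠ 0 ∧ j.val ≠ N then W s i j else 0) =
        schur s ((pinnedChain ω₂ lam β γ).bondCurrent N b)
          (fun z => ∑ c : Fin N, (pinnedChain ω₂ lam β γ).bondCurrent N c z) :=
    fun {s} hs i b hib hiN => bulk_row_sum_pkg (ω₂ := ω₂) (lam := lam) (β := β) (γ := γ) (N := N) (T := T)
      (corr := fun f₁ f₂ t => (∫ z, f₁ z * (∫ y, f₂ y ∂((pinnedChain ω₂ lam β γ).transitionKernel N T T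
        t.toNNReal z)) ∂(pinnedChain ω₂ lam β γ).gibbsMeasure N T) -
        (∫ z, f₁ z ∂(pinnedChain ω₂ lam β γ).gibbsMeasure N T) * (∫ z, f₂ z ∂(pinnedChain ω₂ lam β γ).gibbsMeasure N T))
      (cov := fun f₁ f₂ => (∫ z, f₁ z * f₂ z ∂(pinnedChain ω₂ lam β γ).gibbsMeasure N T) -
        (∫ z, f₁ z ∂(pinnedChain ω₂ lam β γ).gibbsMeasure N T) * (∫ z, f₂ z ∂(pinnedChain ω₂ lam β γ).gibbsMeasure N T))
      (fun f => Iff.rfl) (fun f g t => rfl) (fun s f g => rfl) (fun x z => rfl) hFI2 hω hl.le hβ.le hT g hg hs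
      (G s) (schur s) (hschur s) (W s) (hW s) i b hib hiN
  -- the contact-row identity `Σ_{bond j} W_{ij} = γ·schur_s(p_c², J)` at a fixed `s ≥ 0`
  have hcontact : ∀ {s : ℝ}, 0 ≤ s → ∀ (i : Fin (N + 1)) (c : Fin N),
      (i.val = 0 ∧ c.val = 0) ∨ (i.val = N ∧ c.val + 1 = N) →
      ∑ j : Fin (N + 1), (if j.val ≠ 0 ∧ j.val ≠ N then W s i j else 0) =
        γ * schur s (fun z => z.2 c ^ 2) (fun z => ∑ b : Fin N, (pinnedChain ω₂ lam β γ).bondCurrent N b z) :=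
    fun {s} hs i c hic => ohm2_contact_row_sum_pkg (ω₂ := ω₂) (lam := lam) (β := β) (γ := γ) (N := N) (T := T)
      (corr := fun f₁ f₂ t => (∫ z, f₁ z * (∫ y, f₂ y ∂((pinnedChain ω₂ lam β γ).transitionKernel N T T
        t.toNNReal z)) ∂(pinnedChain ω₂ lam β γ).gibbsMeasure N T) -
        (∫ z, f₁ z ∂(pinnedChain ω₂ lam β γ).gibbsMeasure N T) * (∫ z, f₂ z ∂(pinnedChain ω₂ lam β γ).gibbsMeasure N T))
      (cov := fun f₁ f₂ => (∫ z, f₁ z * f₂ z ∂(pinnedChain ω₂ lam β γ).gibbsMeasure N T) -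
        (∫ z, f₁ z ∂(pinnedChain ω₂ lam β γ).gibbsMeasure N T) * (∫ z, f₂ z ∂(pinnedChain ω₂ lam β γ).gibbsMeasure N T))
      (fun f => Iff.rfl) (fun f g t => rfl) (fun s f g => rfl) (fun x z => rfl) hFI2 hω hl.le hβ.le hγ.le hT g hg
      (by omega) hs (G s) (schur s) (hschur s) (W s) (hW s) i c hic
  refine ⟨fun b hb => ?_, fun b hb => ?_⟩
  · -- bond clause: position `i = b + 1 ≤ N − 1`
    have hadm_b := adm_bondCurrent (fun f : PhaseSpace N → ℝ => Continuous f ∧ ∃ A : ℝ, ∀ z,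
      |f z| ≤ A * Real.exp ((pinnedChain ω₂ lam β γ).hamiltonian N z / (8 * T))) (fun f => Iff.rfl) hω hl.le hβ.le hT b
    have hρ := hlim _ _ hadm_b hadm_J
    have hib : b.val + 1 = (b.succ : Fin (N + 1)).val := (Fin.val_succ b).symm
    have hiN : (b.succ : Fin (N + 1)).val ≠ N := by
      rw [Fin.val_succ]
      omega
    have hi0 : (b.succ : Fin (N + 1)).val ≠ 0 := by
      rw [Fin.val_succ]
      omega
    refine ⟨_, hρ, ?_, fun hR1 hR2 => ?_⟩
    · refine le_trans (le_of_tendsto hρ.abs ?_) (le_max_left _ _)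
      filter_upwards [Ioo_mem_nhdsGT (lt_min hs₁ hs₂)] with s hs
      rw [← hbond hs.1.le b.succ b hib hiN]
      exact ohm2_bond_row_abs_le (by omega) b.succ hi0 hiN (W s b.succ) CF (τ 0)
        (hFi s hs.1 (lt_of_lt_of_le hs.2 (min_le_right _ _)) b.succ)
        (hBi s hs.1 (lt_of_lt_of_le hs.2 (min_le_left _ _)) b.succ 0)
    · refine le_of_tendsto (hρ.sub_const k).abs ?_
      filter_upwards [Ioo_mem_nhdsGT hs₃] with s hs
      rw [← hbond hs.1.le b.succ b hib hiN, ← ohm2_bond_indicator_sum]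
      exact hRi s hs.1 hs.2 b.succ (by rw [Fin.val_succ]; omega) (by rw [Fin.val_succ]; omega)
  · -- contact clause: position `i = 0` (site `0`) or `i = N` (site `N − 1`)
    have hadm_p := adm_psq (fun f : PhaseSpace N → ℝ => Continuous f ∧ ∃ A : ℝ, ∀ z,
      |f z| ≤ A * Real.exp ((pinnedChain ω₂ lam β γ).hamiltonian N z / (8 * T))) (fun f => Iff.rfl) hω hl.le hβ.le hT b
    have hw := hlim _ _ hadm_p hadm_J
    obtain ⟨i, hic⟩ : ∃ i : Fin (N + 1), (i.val = 0 ∧ b.val = 0) ∨ (i.val = N ∧ b.val + 1 = N) := by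
      rcases hb with h | h
      · exact ⟨⟨0, Nat.succ_pos N⟩, Or.inl ⟨rfl, h⟩⟩
      · exact ⟨⟨N, Nat.lt_succ_self N⟩, Or.inr ⟨rfl, by omega⟩⟩
    have hi : i.val = 0 ∨ i.val = N := hic.imp And.left And.left
    refine ⟨_, hw, le_trans (le_of_tendsto hw.abs ?_) (le_max_right _ _)⟩
    filter_upwards [Ioo_mem_nhdsGT hs₁] with s hs
    rw [le_div_iff₀ hγ]
    have h1 := hcontact hs.1.le i b hic
    have h2 := ohm2_contact_row_abs_le i hi (W s i) (τ 0) (hBi s hs.1 hs.2 i 0)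
    rw [h1, abs_mul, abs_of_pos hγ] at h2
    linarith

/-! ### The link theorem -/

/-- **LINK: the line's rank-2 inputs imply the route's rank-2 crux `OrthogonalOhm` as typed** (registered link
theorem of line `limit-operator-memory-form`, crux `RobinCoercivity`). Under (U′) `BlockBandDomination` (`hU`), (L)
`BlockBulkLimit` (`hL`) and the flux-row bound `FluxRowBound` (`hF`): for `pinnedChain ω₂ lam β γ` (all `> 0`) and
`T > 0`, with `k = Σ' K_∞` from `bulkRowSum_of_blockInputs hU hL` and `C = max (C_F + τ 0) (τ 0 / γ)`, for every
`ε > 0` the bulk depth `R(ε)` of `bulkRowSum_of_blockInputs` works: at every `N ≥ 2` the orthogonal DC responses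
`ρ_b = lim_{s↓0} schur_s(j_b, J)` exist, `|ρ_b| ≤ C`, `|ρ_b − k| ≤ ε` for `b` at distance `≥ R` from both ends, and the
two contact responses `lim_{s↓0} schur_s(p_c², J)`, `c ∈ {0, N−1}`, exist with modulus `≤ C` (`ohm2_fixedN` over the
route decl's own `let`-gadgets). -/
theorem orthogonalOhm_of_blockInputs (hU : BlockBandDomination) (hL : BlockBulkLimit) (hF : FluxRowBound) :
    OrthogonalOhm := by
  have hk0 := bulkRowSum_of_blockInputs hU hL
  unfold BlockBandDomination at hU
  unfold FluxRowBound at hF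
  intro ω₂ lam β γ hω hl hβ hγ T hT
  obtain ⟨τ, -, hUN⟩ := hU ω₂ lam β γ hω hl hβ hγ T hT
  obtain ⟨CF, hFN⟩ := hF ω₂ lam β γ hω hl hβ hγ T hT
  obtain ⟨k, hk⟩ := hk0 ω₂ lam β γ hω hl hβ hγ T hT
  refine ⟨k, max (CF + τ 0) (τ 0 / γ), fun ε hε => ?_⟩
  obtain ⟨R, hR⟩ := hk ε hε
  refine ⟨R, fun N hN => ?_⟩
  obtain ⟨s₁, hs₁, h1⟩ := hUN N hN
  obtain ⟨s₂, hs₂, h2⟩ := hFN N hN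
  obtain ⟨s₃, hs₃, h3⟩ := hR N hN
  intro P X μ corr lap e G schur J
  exact ohm2_fixedN hω hl hβ hγ hT hN lap e G schur _ _ (fun _ _ _ => rfl) (fun _ _ => rfl) (fun _ => rfl)
    (fun _ _ _ => rfl) (fun _ _ => rfl) (fun _ _ _ => rfl) k CF ε s₁ s₂ s₃ hs₁ hs₂ hs₃ τ R
    (h1 lap e G schur _ _ (fun _ _ _ => rfl) (fun _ _ => rfl) (fun _ => rfl) (fun _ _ _ => rfl) (fun _ _ => rfl)
      (fun _ _ _ => rfl))
    (h2 lap e G schur _ _ (fun _ _ _ => rfl) (fun _ _ => rfl) (fun _ => rfl) (fun _ _ _ => rfl) (fun _ _ => rfl)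
      (fun _ _ _ => rfl))
    (h3 lap e G schur _ _ (fun _ _ _ => rfl) (fun _ _ => rfl) (fun _ => rfl) (fun _ _ _ => rfl) (fun _ _ => rfl)
      (fun _ _ _ => rfl))

end Summit.AtomisticToContinuum.FouriersLaw.Theorems.HonestZwanzig.Robin

end
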